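import Summits.MatrixMultiplication.OmegaCensus.STPPCrossReadingCosetClash
import Summits.MatrixMultiplication.OmegaCensus.STPPKernelListerOrderN36D
import Summits.MatrixMultiplication.OmegaCensus.STPPPatternMonotonicity
import Summits.MatrixMultiplication.OmegaCensus.STPPAlignedBlockFilter

/-!
# ω-census (abelian STPP census): NO beating STPP family in any abelian group of order `36` — UNCONDITIONAL, by a Sylow coset clash (kernel)

HONEST FRAMING (pub-omega census; verbatim): lottery ticket; floor = certified bounds/negative ranges.
Census STRUCTURE (seat pub-omega-stpp-2 gen 31, 2026-08-29), family (b2).  The one survivor of the kernel lister at order `36` (`deadN36 =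
{111_233_233}`, `…OrderN36D.lean`, stpp-2 g30; four abelian groups `ℤ₃₆, ℤ₂×ℤ₁₈, ℤ₃×ℤ₁₂, ℤ₆²`) is killed by the cross-reading coset clash of
`STPPCrossReadingCosetClash.lean` with a HALL uniqueness lemma (`eq_of_card_eq_coprime`: two subgroup carriers of the same order `q` with
`gcd(q, |H|/q) = 1` coincide — Lagrange for `K₁ + K₂` and `K₁ ∩ K₂` via the fibre count `#(K₁ + K₂)·#(K₁ ∩ K₂) = #K₁·#K₂`): at the block `(2,3,3)` of index `1`,
reading `(A,B,C)` pins the outer Kneser stabilizer to order `4` and puts `B₁` in one coset of it, reading `(A,C,B)` (family `(−A,−C,−B)`) does the same for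
`C₁`; the subgroup of order `4` of an abelian group of order `36` is unique (Sylow), so `C₁ − B₁` lies in one coset — but it has `9 > 4` elements (TPP).  Hence
`volume_le_of_card_eq_36`.  Nothing here is progress on `ω`.

References: M. Kneser, Math. Z. 58 (1953); H. Cohn, R. Kleinberg, B. Szegedy, C. Umans, FOCS 2005 (arXiv:math/0511460), Def. 5.1.
-/

open Finset
open scoped Pointwise

namespace Summit.MatrixMultiplication.OmegaCensus.CubeNB

open Literature.Computability.AlgebraicComplexity
open Literature.Combinatorics.Additive
open Summit.MatrixMultiplication.OmegaCensus.STPPKneser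

variable {H : Type*} [AddCommGroup H] [DecidableEq H] [Fintype H]

omit [Fintype H] in
/-- **Product formula for subgroup carriers**: `#(K₁ + K₂) · #(K₁ ∩ K₂) = #K₁ · #K₂` (every fibre of addition on `K₁ × K₂` is a translate of
the intersection). [folklore] -/
theorem card_add_mul_card_inter {K₁ K₂ : Finset H} (h₁ : IsSubgroupCarrier K₁) (h₂ : IsSubgroupCarrier K₂) :
    #(K₁ + K₂) * #(K₁ ∩ K₂) = #K₁ * #K₂ := by
  classical
  rw [← Finset.card_product K₁ K₂]
  -- count K₁ ×ˢ K₂ by the fibres of (x, y) ↦ x + y over K₁ + K₂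
  have hmaps : ∀ p ∈ K₁ ×ˢ K₂, (fun p : H × H => p.1 + p.2) p ∈ K₁ + K₂ := by
    intro p hp
    rw [Finset.mem_product] at hp
    exact Finset.add_mem_add hp.1 hp.2
  rw [Finset.card_eq_sum_card_fiberwise hmaps]
  have hfib : ∀ s ∈ K₁ + K₂, #((K₁ ×ˢ K₂).filter fun p : H × H => p.1 + p.2 = s) = #(K₁ ∩ K₂) := by
    intro s hs
    obtain ⟨x, hx, y, hy, rfl⟩ := Finset.mem_add.1 hs
    -- the fibre is the image of K₁ ∩ K₂ under i ↦ (x + i, y - i)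
    have heq : ((K₁ ×ˢ K₂).filter fun p : H × H => p.1 + p.2 = x + y) = (K₁ ∩ K₂).image fun i => (x + i, y - i) := by
      ext ⟨u, v⟩
      simp only [Finset.mem_filter, Finset.mem_product, Finset.mem_image, Finset.mem_inter, Prod.mk.injEq]
      constructor
      · rintro ⟨⟨hu, hv⟩, huv⟩
        refine ⟨u - x, ⟨h₁.sub_mem hu hx, ?_⟩, by abel, ?_⟩
        · have : u - x = y - v := by
            have h' := huv; rw [← sub_eq_zero] at h' ⊢; rw [← h']; abel
          rw [this]; exact h₂.sub_mem hy hv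
        · have h' := huv
          have : v = x + y - u := by rw [← h']; abel
          rw [this]; abel
      · rintro ⟨i, ⟨hi1, hi2⟩, rfl, rfl⟩
        exact ⟨⟨h₁.add_mem hx hi1, h₂.sub_mem hy hi2⟩, by abel⟩
    rw [heq, Finset.card_image_of_injective]
    intro i j hij
    simpa using (Prod.mk.inj hij).1
  rw [Finset.sum_congr rfl hfib, Finset.sum_const, smul_eq_mul]

/-- **Hall uniqueness**: two subgroup carriers of the same order `q` with `gcd(q, |H|/q) = 1` coincide (e.g. Sylow subgroups of an abelian group).
[folklore] -/
theorem eq_of_card_eq_coprime {K₁ K₂ : Finset H} (h₁ : IsSubgroupCarrier K₁) (h₂ : IsSubgroupCarrier K₂) {q m : ℕ}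
    (hK₁ : #K₁ = q) (hK₂ : #K₂ = q) (hn : Fintype.card H = q * m) (hqm : Nat.Coprime q m) : K₁ = K₂ := by
  have hq : 0 < q := hK₁ ▸ h₁.nonempty.card_pos
  have hI := h₁.inter h₂
  have hS : IsSubgroupCarrier (K₁ + K₂) := by
    refine ⟨by simpa using Finset.add_mem_add h₁.zero_mem h₂.zero_mem, ?_⟩
    intro x hx y hy
    obtain ⟨x1, hx1, x2, hx2, rfl⟩ := Finset.mem_add.1 hx
    obtain ⟨y1, hy1, y2, hy2, rfl⟩ := Finset.mem_add.1 hy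
    have : x1 + x2 - (y1 + y2) = (x1 - y1) + (x2 - y2) := by abel
    rw [this]
    exact Finset.add_mem_add (h₁.sub_mem hx1 hy1) (h₂.sub_mem hx2 hy2)
  have hK₂S : K₂ ⊆ K₁ + K₂ := fun y hy => by simpa using Finset.add_mem_add h₁.zero_mem hy
  have hK₁S : K₁ ⊆ K₁ + K₂ := fun x hx => by simpa using Finset.add_mem_add hx h₂.zero_mem
  have huniv : IsSubgroupCarrier (Finset.univ : Finset H) := ⟨Finset.mem_univ _, fun _ _ _ _ => Finset.mem_univ _⟩
  -- #S = q * j with j ∣ m, and j * #I = q with #I ∣ q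
  obtain ⟨j, hj⟩ : #K₂ ∣ #(K₁ + K₂) := IsSubgroupCarrier.card_dvd_of_subset h₂ hS hK₂S
  have hSn : #(K₁ + K₂) ∣ q * m := hn ▸ IsSubgroupCarrier.card_dvd_of_subset hS huniv (Finset.subset_univ _)
  have hprod := card_add_mul_card_inter h₁ h₂
  rw [hj, hK₁, hK₂] at hprod
  rw [hj, hK₂] at hSn
  have hjm : j ∣ m := Nat.dvd_of_mul_dvd_mul_left hq hSn
  have hjq : j ∣ q := ⟨#(K₁ ∩ K₂), by
    have : q * (j * #(K₁ ∩ K₂)) = q * q := by rw [← hprod]; ring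
    exact (Nat.eq_of_mul_eq_mul_left hq this).symm⟩
  have hj1 : j = 1 := Nat.eq_one_of_dvd_coprimes hqm hjq hjm
  have hSeq : K₁ + K₂ = K₂ := (Finset.eq_of_subset_of_card_le hK₂S (by rw [hj, hj1, mul_one])).symm
  have hsub : K₁ ⊆ K₂ := hSeq ▸ hK₁S
  exact Finset.eq_of_subset_of_card_le hsub (by rw [hK₁, hK₂])

/-- **`{(1,1,1),(2,3,3),(2,3,3)}` has no STPP realisation in any abelian group of order `36`** (Sylow coset clash at the block of index `1`).
[cite: Kneser1953] [cite: CohnKleinbergSzegedyUmans2005, Def. 5.1] -/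
theorem no_isSTPP_card36_111_233_233 (hH : Fintype.card H = 36) (A B C : Fin 3 → Finset H) (hS : IsSTPP A B C)
    (hA : ∀ i, #(A i) = ![1, 2, 2] i) (hB : ∀ i, #(B i) = ![1, 3, 3] i) (hC : ∀ i, #(C i) = ![1, 3, 3] i) : False := by
  have hAne : ∀ i, (A i).Nonempty := fun i => card_pos.1 (by rw [hA]; fin_cases i <;> simp)
  have hBne : ∀ i, (B i).Nonempty := fun i => card_pos.1 (by rw [hB]; fin_cases i <;> simp)
  have hCne : ∀ i, (C i).Nonempty := fun i => card_pos.1 (by rw [hC]; fin_cases i <;> simp)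
  have e1 : (univ : Finset (Fin 3)).erase 1 = {0, 2} := by decide
  have hI : ((univ : Finset (Fin 3)).erase 1).Nonempty := ⟨0, by decide⟩
  -- reading (A,B,C) at block 1: B₁ in one coset of K₁, #K₁ = 4
  obtain ⟨K₁, hK₁, hK₁4, b, hb, hB1⟩ := exists_carrier_middle_subset_coset' hS hAne hBne hCne 1 hI (n := 36) (q := 4)
    (z := 7) (b := 3) (vol := 18) (a := 2) (L := 10) hH (by rw [hA]; rfl) (by rw [hB]; rfl) (by rw [hA, hB, hC]; rfl)
    (by rw [e1, Finset.sum_pair (by decide)]; simp [hA, hC]) (by rw [e1, Finset.sum_pair (by decide)]; simp [hB, hC]) (by decide)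
  -- reading (A,C,B): the family (−A, −C, −B); block 1: −C₁ in one coset of K₂, #K₂ = 4
  have hR : IsSTPP (fun j => -(A j)) (fun j => -(C j)) (fun j => -(B j)) := stpp_rotate (stpp_rotate (isSTPP_neg_reverse hS))
  obtain ⟨K₂, hK₂, hK₂4, c, hc, hC1⟩ := exists_carrier_middle_subset_coset' hR (nonempty_neg_family hAne) (nonempty_neg_family hCne)
    (nonempty_neg_family hBne) 1 hI (n := 36) (q := 4) (z := 7) (b := 3) (vol := 18) (a := 2) (L := 10) hH
    (by rw [card_neg_family, hA]; rfl) (by rw [card_neg_family, hC]; rfl) (by rw [card_neg_family, card_neg_family, card_neg_family, hA, hB, hC]; rfl)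
    (by rw [e1, Finset.sum_pair (by decide)]; simp [hA, hB])
    (by rw [e1, Finset.sum_pair (by decide)]; simp [hC, hB]) (by decide)
  -- the subgroup of order 4 is unique (36 = 4 · 9, gcd 1)
  have hK : K₁ = K₂ := eq_of_card_eq_coprime hK₁ hK₂ (m := 9) hK₁4 hK₂4 (by rw [hH]) (by decide)
  subst hK
  have hD : D B C 1 ⊆ (-c - b) +ᵥ K₁ := by
    intro x hx
    obtain ⟨b', hb', c', hc', rfl⟩ := mem_D.1 hx
    have h1 : b' - b ∈ K₁ := (hK₁.mem_coset_iff).1 (hB1 hb')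
    have h2 : -c' - c ∈ K₁ := (hK₁.mem_coset_iff).1 (hC1 (by simpa using hc'))
    rw [hK₁.mem_coset_iff]
    have : c' - b' - (-c - b) = -(-c' - c) - (b' - b) := by abel
    rw [this]
    exact hK₁.sub_mem (hK₁.neg_mem h2) h1
  have := Finset.card_le_card hD
  rw [Finset.card_vadd_finset, hK₁4, card_D_BC hS hAne 1, hB, hC] at this
  exact absurd this (by decide)

section Capstone

open Summit.MatrixMultiplication.OmegaCensus.KLister

/-- `111_233_233` is not realisable in any abelian group of order `36`. [cite: CohnKleinbergSzegedyUmans2005, Def. 5.1] -/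
theorem notRealizable_card36_111_233_233 (hH : Fintype.card H = 36) :
    ¬ Realizable H ([(1, 1, 1), (2, 3, 3), (2, 3, 3)] : List Shape) := by
  intro h
  obtain ⟨A, B, C, hS, hc⟩ := h.out
  exact no_isSTPP_card36_111_233_233 hH A B C hS (fun i => by fin_cases i <;> exact (hc _).2.2.2.1)
    (fun i => by fin_cases i <;> exact (hc _).2.2.2.2.1) (fun i => by fin_cases i <;> exact (hc _).2.2.2.2.2)

end Capstone

end Summit.MatrixMultiplication.OmegaCensus.CubeNB

namespace Summit.MatrixMultiplication.OmegaCensus.KLister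

open Literature.Computability.AlgebraicComplexity
open Summit.MatrixMultiplication.OmegaCensus.CubeNB

/-- **Order 36: no beating STPP family (kernel, unconditional, all four abelian groups of order 36).** [cite: CohnKleinbergSzegedyUmans2005, Def. 5.1] [cite: Kneser1953] -/
theorem volume_le_of_card_eq_36 {H : Type*} [AddCommGroup H] [Fintype H] [DecidableEq H] (hH : Fintype.card H = 36)
    {m : ℕ} (A B C : Fin m → Finset H) (hS : IsSTPP A B C) : ∑ i, #(A i) * #(B i) * #(C i) ≤ 36 := by
  refine volume_le_of_card_eq_36_of_dead hH ?_ A B C hS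
  intro D hD
  simp only [deadN36, List.mem_cons, List.not_mem_nil, or_false] at hD
  subst hD
  exact notRealizable_card36_111_233_233 hH

end Summit.MatrixMultiplication.OmegaCensus.KLister
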